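import Summits.QuantumFields.YangMills.Theorems.BackwardLiouvilleRigidityFlatRatioTerminationConeExtension
import Summits.QuantumFields.YangMills.Theorems.BackwardLiouvilleRigidityFlatRatioTerminationFarPoint

/-!
# Extension of unit boundary data over a lattice cell of `ℤ³` with bond control `K(Λ)/m`
# (toolkit for the stub `stub_innerWindowGaugeSmall` of `BackwardLiouvilleRigidity.FlatRatioTermination`, stmt-QuantumFields-22542)

`cell_extension`: for every `Λ ≥ 0` and every cell `c` of half-side `m ≥ 1` in `ℤ³`, unit-quaternion boundary data `t` with bond
oscillation `σ ≤ Λ/m` along `∂c` extend to unit data on the whole cell agreeing with `t` on `∂c` and with bond oscillation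
`≤ coneK Λ / m`, `coneK Λ = 100·(12Λ' + 3)²·(16 + 36Λ')`, `Λ' = max Λ 1` — uniformly in the size of the cell.  Proof: a far
point `q` for the boundary values (`…FarPoint.exists_far_unit_quaternion` applied to the `6(N+1)²` values at the ANCHORS of a
sub-grid of mesh `P ≍ ρ m/Λ` of the boundary, every boundary value being within `σ·3(P−1) ≤ ρ` of an anchor value by
`face_osc`), then the cone extension `…ConeExtension.cone_extension` with margin `ρ = 1/(100(12Λ'+3)²)`.

HONEST SCOPE.  Elementary, `--supports stmt-QuantumFields-22542`; nothing about gauge fields yet, the crux, rung R3 or any summit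
statement; nothing here bears on the Yang–Mills mass gap.
-/

namespace Summit.QuantumFields.YangMills.Theorems.FlatRatioTermination.Cone

open Finset
open scoped Quaternion

namespace Cell

variable (c : Cell 3)

/-- In `Fin 3` the two indices other than `κ₀` are `κ₀ + 1` and `κ₀ + 2`. [folklore] -/
theorem fin3_eq_add (κ₀ κ : Fin 3) (h : κ ≠ κ₀) : κ = κ₀ + 1 ∨ κ = κ₀ + 2 := by
  revert κ₀ κ h; decide

/-- `κ₀ + 1 ≠ κ₀` and `κ₀ + 2 ≠ κ₀`, `κ₀ + 1 ≠ κ₀ + 2` in `Fin 3`. [folklore] -/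
theorem fin3_add_ne (κ₀ : Fin 3) : κ₀ + 1 ≠ κ₀ ∧ κ₀ + 2 ≠ κ₀ ∧ κ₀ + 2 ≠ κ₀ + 1 := by
  revert κ₀; decide

/-- The ANCHOR of the boundary sub-grid of mesh `P` with index `(κ₀, b, w₁, w₂)`: coordinate `κ₀` on the face `b`, the two other
coordinates at `min (lo + P·w) hi`. [folklore] -/
def anchor (P : ℕ) (z : Fin 3 × Bool × ℕ × ℕ) : Fin 3 → ℤ := fun κ =>
  if κ = z.1 then (if z.2.1 then c.hi κ else c.lo κ)
  else if κ = z.1 + 1 then min (c.lo κ + P * z.2.2.1) (c.hi κ) else min (c.lo κ + P * z.2.2.2) (c.hi κ)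

/-- Anchors lie in the box. [folklore] -/
theorem anchor_mem_box (P : ℕ) (z : Fin 3 × Bool × ℕ × ℕ) : c.anchor P z ∈ c.box := by
  intro κ
  have hlohi : c.lo κ ≤ c.hi κ := by
    by_cases h : κ ∈ c.D
    · rw [c.hi_of_mem h]; have := c.m; omega
    · rw [c.hi_of_not_mem h]
  unfold anchor
  split_ifs with h1 h2 h3
  · exact ⟨hlohi, le_rfl⟩
  · exact ⟨le_rfl, hlohi⟩
  · exact ⟨le_min (le_add_of_nonneg_right (by positivity)) hlohi, min_le_right _ _⟩
  · exact ⟨le_min (le_add_of_nonneg_right (by positivity)) hlohi, min_le_right _ _⟩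

/-- Integer bookkeeping of the sub-grid: `lo + P·⌊n/P⌋ ≤ lo + n < lo + P·⌊n/P⌋ + P`. [folklore] -/
theorem subgrid_bounds (P n : ℕ) (hP : 0 < P) :
    (P : ℤ) * (n / P : ℕ) ≤ n ∧ (n : ℤ) ≤ (P : ℤ) * (n / P : ℕ) + (P - 1) := by
  have h1 : P * (n / P) ≤ n := Nat.mul_div_le n P
  have h2 : n < P * (n / P) + P := by
    have := Nat.div_add_mod n P
    have := Nat.mod_lt n hP
    omega
  constructor
  · exact_mod_cast h1
  · have : (n : ℤ) < (P : ℤ) * (n / P : ℕ) + P := by exact_mod_cast h2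
    omega

/-- The anchor of a boundary point: a boundary point of the same face within `P − 1` of it in every coordinate. [folklore] -/
theorem exists_anchor_near {P : ℕ} (hP : 1 ≤ P) {x : Fin 3 → ℤ} (hx : x ∈ c.bdry) :
    ∃ z : Fin 3 × Bool × ℕ × ℕ, z.2.2.1 ≤ 2 * c.m / P ∧ z.2.2.2 ≤ 2 * c.m / P ∧ z.1 ∈ c.D ∧
      c.anchor P z z.1 = x z.1 ∧ (x z.1 = c.lo z.1 ∨ x z.1 = c.lo z.1 + 2 * c.m) ∧
      l1norm (x - c.anchor P z) ≤ 3 * (P - 1) := by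
  obtain ⟨hxb, κ₀, hκ₀, hv⟩ := hx
  obtain ⟨hn1, hn2, hn21⟩ := fin3_add_ne κ₀
  have hP0 : 0 < P := hP
  have hcoord : ∀ κ, 0 ≤ x κ - c.lo κ ∧ x κ - c.lo κ ≤ 2 * c.m := by
    intro κ
    have h := hxb κ
    by_cases hκ : κ ∈ c.D
    · rw [c.hi_of_mem hκ] at h; omega
    · rw [c.hi_of_not_mem hκ] at h; omega
  -- the residues in the two other coordinates
  set n₁ : ℕ := (x (κ₀ + 1) - c.lo (κ₀ + 1)).toNat with hn₁
  set n₂ : ℕ := (x (κ₀ + 2) - c.lo (κ₀ + 2)).toNat with hn₂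
  have hn₁' : (n₁ : ℤ) = x (κ₀ + 1) - c.lo (κ₀ + 1) := Int.toNat_of_nonneg (hcoord _).1
  have hn₂' : (n₂ : ℤ) = x (κ₀ + 2) - c.lo (κ₀ + 2) := Int.toNat_of_nonneg (hcoord _).1
  have hn₁le : n₁ ≤ 2 * c.m := by have := (hcoord (κ₀ + 1)).2; omega
  have hn₂le : n₂ ≤ 2 * c.m := by have := (hcoord (κ₀ + 2)).2; omega
  obtain ⟨hk₁a, hk₁b⟩ := subgrid_bounds P n₁ hP0
  obtain ⟨hk₂a, hk₂b⟩ := subgrid_bounds P n₂ hP0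
  -- the face bit
  set b : Bool := if x κ₀ = c.lo κ₀ then false else true with hb
  have hface : (if b then c.hi κ₀ else c.lo κ₀) = x κ₀ := by
    rcases hv with h | h
    · simp [hb, h]
    · by_cases h0 : x κ₀ = c.lo κ₀
      · simp [hb, h0]
      · simp [hb, h, c.hi_of_mem hκ₀]
  refine ⟨(κ₀, b, n₁ / P, n₂ / P), Nat.div_le_div_right hn₁le, Nat.div_le_div_right hn₂le, hκ₀, ?_, hv, ?_⟩
  · simpa [anchor] using hface
  · -- coordinatewise: `0 ≤ x κ − anchor κ ≤ P − 1`
    have hv1 : c.anchor P (κ₀, b, n₁ / P, n₂ / P) (κ₀ + 1) = c.lo (κ₀ + 1) + P * (n₁ / P : ℕ) := by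
      simp only [anchor, if_neg hn1, if_true]
      exact min_eq_left (by have := (hxb (κ₀ + 1)).2; omega)
    have hv2 : c.anchor P (κ₀, b, n₁ / P, n₂ / P) (κ₀ + 2) = c.lo (κ₀ + 2) + P * (n₂ / P : ℕ) := by
      simp only [anchor, if_neg hn2, if_neg hn21]
      exact min_eq_left (by have := (hxb (κ₀ + 2)).2; omega)
    have hv0 : c.anchor P (κ₀, b, n₁ / P, n₂ / P) κ₀ = x κ₀ := by simpa [anchor] using hface
    have key : ∀ κ, ((x - c.anchor P (κ₀, b, n₁ / P, n₂ / P)) κ).natAbs ≤ P - 1 := by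
      intro κ
      rw [Pi.sub_apply]
      by_cases h0 : κ = κ₀
      · subst h0; rw [hv0]; simp
      · rcases fin3_eq_add κ₀ κ h0 with h1 | h2
        · subst h1; rw [hv1]; omega
        · subst h2; rw [hv2]; omega
    unfold l1norm
    calc ∑ ι, ((x - c.anchor P (κ₀, b, n₁ / P, n₂ / P)) ι).natAbs
        ≤ ∑ _ι : Fin 3, (P - 1) := Finset.sum_le_sum fun ι _ => key ι
      _ = 3 * (P - 1) := by simp

/-- The explicit bond constant of the cell extension: `100·(12Λ' + 3)²·(16 + 36Λ')`, `Λ' = max Λ 1`. [folklore] -/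
noncomputable def coneK (Λ : ℝ) : ℝ := 100 * (12 * max Λ 1 + 3) ^ 2 * (16 + 36 * max Λ 1)

/-- `coneK` is positive. [folklore] -/
theorem coneK_pos (Λ : ℝ) : 0 < coneK Λ := by
  unfold coneK
  have : (1 : ℝ) ≤ max Λ 1 := le_max_right _ _
  positivity

/-- `max 1 ⌊y⌋₊ ≥ y/2` for `y ≥ 0`. [folklore] -/
theorem half_le_max_one_floor (y : ℝ) : y / 2 ≤ ((max 1 ⌊y⌋₊ : ℕ) : ℝ) := by
  rcases le_or_gt y 2 with h | h
  · have : (1 : ℝ) ≤ ((max 1 ⌊y⌋₊ : ℕ) : ℝ) := by exact_mod_cast le_max_left 1 ⌊y⌋₊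
    linarith
  · have h1 : (⌊y⌋₊ : ℝ) ≤ ((max 1 ⌊y⌋₊ : ℕ) : ℝ) := by exact_mod_cast le_max_right 1 ⌊y⌋₊
    have h2 := Nat.lt_floor_add_one y
    linarith

/-- THE MESH PARAMETERS: with `ρ = 1/(100(12Λ'+3)²)`, `P = max 1 ⌊ρm/(3Λ')⌋`, `N = ⌊2m/P⌋`: `0 < ρ`, `2ρ ≤ 1/2`, the covering radius
`(Λ'/m)·3(P−1) ≤ ρ`, and the count inequality `2·(6(N+1)²)·(2ρ)³ < 1`. [folklore] -/
theorem mesh_params {Λ' : ℝ} (hΛ' : 1 ≤ Λ') {m : ℕ} (hm : 1 ≤ m) :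
    0 < 1 / (100 * (12 * Λ' + 3) ^ 2) ∧ 2 * (1 / (100 * (12 * Λ' + 3) ^ 2)) ≤ 1 / 2 ∧
    1 ≤ max 1 ⌊1 / (100 * (12 * Λ' + 3) ^ 2) * m / (3 * Λ')⌋₊ ∧
    Λ' / m * (3 * ((max 1 ⌊1 / (100 * (12 * Λ' + 3) ^ 2) * m / (3 * Λ')⌋₊ - 1 : ℕ) : ℝ))
      ≤ 1 / (100 * (12 * Λ' + 3) ^ 2) ∧
    2 * (6 * (((2 * m / max 1 ⌊1 / (100 * (12 * Λ' + 3) ^ 2) * m / (3 * Λ')⌋₊ : ℕ) : ℝ) + 1) ^ 2)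
      * (2 * (1 / (100 * (12 * Λ' + 3) ^ 2))) ^ 3 < 1 := by
  have hm' : (0 : ℝ) < m := by exact_mod_cast hm
  set A : ℝ := 3 * Λ' with hA
  have hA0 : 0 < A := by positivity
  set ρ : ℝ := 1 / (100 * (12 * Λ' + 3) ^ 2) with hρdef
  have hρ : 0 < ρ := by positivity
  have h225 : (225 : ℝ) ≤ (12 * Λ' + 3) ^ 2 := by nlinarith
  have hρsmall : ρ ≤ 1 / 22500 := by
    rw [hρdef, div_le_div_iff₀ (by positivity) (by norm_num)]; nlinarith
  set P : ℕ := max 1 ⌊ρ * m / A⌋₊ with hPdef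
  have hP : 1 ≤ P := le_max_left _ _
  have hP0 : (0 : ℝ) < P := by exact_mod_cast hP
  refine ⟨hρ, by linarith, hP, ?_, ?_⟩
  · -- covering radius
    have h1 : P - 1 ≤ ⌊ρ * m / A⌋₊ := by simp only [hPdef]; omega
    have h2 : ((P - 1 : ℕ) : ℝ) ≤ ⌊ρ * m / A⌋₊ := by exact_mod_cast h1
    have hPsub : ((P - 1 : ℕ) : ℝ) ≤ ρ * m / A := h2.trans (Nat.floor_le (by positivity))
    calc Λ' / m * (3 * ((P - 1 : ℕ) : ℝ)) ≤ (Λ' / m) * (3 * (ρ * m / A)) := by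
          apply mul_le_mul_of_nonneg_left _ (by positivity); linarith
      _ = ρ := by rw [hA]; field_simp
  · -- the count
    have hPlow : ρ * m / A / 2 ≤ (P : ℝ) := half_le_max_one_floor _
    set N : ℕ := 2 * m / P with hNdef
    have hN : (N : ℝ) + 1 ≤ 4 * A / ρ + 1 := by
      have h1 : (N : ℝ) ≤ (2 * m : ℕ) / (P : ℝ) := Nat.cast_div_le
      have h2 : ((2 * m : ℕ) : ℝ) / (P : ℝ) ≤ 4 * A / ρ := by
        rw [div_le_div_iff₀ hP0 hρ]; push_cast
        have h3 : ρ * m ≤ P * (A * 2) := by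
          have := hPlow; rw [div_div, div_le_iff₀ (by positivity)] at this; exact this
        nlinarith
      linarith
    have h2 : ((N : ℝ) + 1) ^ 2 * ρ ^ 2 ≤ (4 * A + ρ) ^ 2 := by
      have : ((N : ℝ) + 1) * ρ ≤ 4 * A + ρ := by
        have := mul_le_mul_of_nonneg_right hN hρ.le
        rw [add_mul, add_mul, div_mul_cancel₀ _ hρ.ne', one_mul] at this
        linarith
      nlinarith [mul_nonneg (by positivity : (0 : ℝ) ≤ (N : ℝ) + 1) hρ.le]
    have h3 : (4 * A + ρ) ^ 2 ≤ (12 * Λ' + 3) ^ 2 := by rw [hA]; nlinarith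
    have h4 : 96 * (12 * Λ' + 3) ^ 2 * ρ < 1 := by
      rw [hρdef]; field_simp; nlinarith
    have h5 : (0 : ℝ) ≤ ((N : ℝ) + 1) ^ 2 := by positivity
    nlinarith [pow_pos hρ 2, mul_le_mul_of_nonneg_left h2 (by norm_num : (0:ℝ) ≤ 96)]

/-- **CELL EXTENSION WITH BOND CONTROL `coneK Λ / m`.**  Unit-quaternion boundary data on a cell of `ℤ³` of half-side `m ≥ 1`
with boundary bond oscillation `σ ≤ Λ/m` extend to unit data on the lattice, equal to `t` on `∂c`, with bond oscillation
`≤ coneK Λ / m` on the cell — uniformly in `m`.  (Anchors of mesh `P = max 1 ⌊ρm/(3Λ')⌋`, `≤ 6(N+1)²` centres with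
`N + 1 ≤ 12Λ'/ρ + 1`, far point at distance `2ρ`, `ρ = 1/(100(12Λ'+3)²)`, cone extension.) [folklore] -/
theorem cell_extension (Λ : ℝ) (hm : 1 ≤ c.m) (t : (Fin 3 → ℤ) → ℍ) {σ : ℝ} (hσ0 : 0 ≤ σ)
    (hσ : σ ≤ Λ / c.m) (ht1 : ∀ x ∈ c.bdry, ‖t x‖ = 1) (hts : c.BdrySteps t σ) :
    ∃ T : (Fin 3 → ℤ) → ℍ, (∀ x ∈ c.bdry, T x = t x) ∧ (∀ x, ‖T x‖ = 1) ∧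
      ∀ (x : Fin 3 → ℤ) (ι : Fin 3), x ∈ c.box → x + Pi.single ι 1 ∈ c.box →
        ‖T x - T (x + Pi.single ι 1)‖ ≤ coneK Λ / c.m := by
  classical
  have hm' : (0 : ℝ) < c.m := by exact_mod_cast hm
  set Λ' : ℝ := max Λ 1 with hΛ'
  have hΛ'1 : 1 ≤ Λ' := le_max_right _ _
  have hσ' : σ ≤ Λ' / c.m := hσ.trans (div_le_div_of_nonneg_right (le_max_left _ _) hm'.le)
  obtain ⟨hρ, hρhalf, hP, hcov, hcount⟩ := mesh_params hΛ'1 hm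
  set ρ : ℝ := 1 / (100 * (12 * Λ' + 3) ^ 2) with hρdef
  set P : ℕ := max 1 ⌊ρ * c.m / (3 * Λ')⌋₊ with hPdef
  set N : ℕ := 2 * c.m / P with hNdef
  -- the centres: boundary values at the anchors
  set idx : Finset (Fin 3 × Bool × ℕ × ℕ) := Finset.univ ×ˢ (Finset.univ ×ˢ (range (N + 1) ×ˢ range (N + 1))) with hidx
  set cen : Finset ℍ := idx.image (fun z => t (c.anchor P z)) with hcen
  have hcard : (cen.card : ℝ) ≤ 6 * ((N : ℝ) + 1) ^ 2 := by
    have h1 : cen.card ≤ idx.card := Finset.card_image_le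
    have h2 : idx.card = 3 * (2 * ((N + 1) * (N + 1))) := by
      simp [hidx, Finset.card_product, Finset.card_range]
    have h3 : (cen.card : ℝ) ≤ (idx.card : ℝ) := by exact_mod_cast h1
    have e : (idx.card : ℝ) = 6 * ((N : ℝ) + 1) ^ 2 := by rw [h2]; push_cast; ring
    linarith
  have hfar_hyp : 2 * (cen.card : ℝ) * (2 * ρ) ^ 3 < 1 := by
    have : 2 * (cen.card : ℝ) * (2 * ρ) ^ 3 ≤ 2 * (6 * ((N : ℝ) + 1) ^ 2) * (2 * ρ) ^ 3 := by
      have : (0 : ℝ) ≤ (2 * ρ) ^ 3 := by positivity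
      nlinarith
    exact lt_of_le_of_lt this hcount
  obtain ⟨q, hq1, hqfar⟩ := exists_far_unit_quaternion cen (by positivity : 0 < 2 * ρ) hρhalf hfar_hyp
  -- the margin `ρ` on the boundary
  have hcovσ : σ * ((3 * (P - 1) : ℕ) : ℝ) ≤ ρ := by
    refine le_trans ?_ hcov
    push_cast
    exact mul_le_mul_of_nonneg_right hσ' (by positivity)
  have htq : ∀ x ∈ c.bdry, ρ ≤ ‖t x - q‖ := by
    intro x hx
    obtain ⟨z, hz1, hz2, hzD, hza, hzv, hzl⟩ := c.exists_anchor_near hP hx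
    have hzidx : z ∈ idx := by
      simp only [hidx, Finset.mem_product, Finset.mem_univ, Finset.mem_range, true_and]
      constructor <;> omega
    have hmem : t (c.anchor P z) ∈ cen := Finset.mem_image_of_mem _ hzidx
    have hfar := hqfar _ hmem
    have hnear : ‖t x - t (c.anchor P z)‖ ≤ ρ := by
      have h1 := c.face_osc hts hzD (v := x z.1) hzv _ x (c.anchor P z) hx.1 (c.anchor_mem_box P z) rfl hza rfl
      refine h1.trans (le_trans ?_ hcovσ)
      exact mul_le_mul_of_nonneg_left (by exact_mod_cast hzl) hσ0
    have := norm_sub_le_norm_sub_add_norm_sub q (t x) (t (c.anchor P z))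
    rw [norm_sub_rev q (t x)] at this
    linarith
  -- the cone extension
  obtain ⟨T, hT1, hT2, hT3⟩ := c.cone_extension hm t hq1 hσ0 hρ ht1 htq hts
  have hK : coneK Λ / c.m = ((16 + 36 * Λ') / c.m) / ρ := by
    rw [coneK, ← hΛ', hρdef]; field_simp
  refine ⟨T, hT1, hT2, fun x ι hx hy => (hT3 x ι hx hy).trans ?_⟩
  · rw [hK]
    refine div_le_div_of_nonneg_right ?_ hρ.le
    have hD : (c.D.card : ℝ) ≤ 3 := by
      have : c.D.card ≤ 3 := by simpa using Finset.card_le_univ c.D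
      exact_mod_cast this
    rw [add_div]
    have : 12 * (c.D.card : ℝ) * σ ≤ 36 * Λ' / c.m := by
      calc 12 * (c.D.card : ℝ) * σ ≤ 12 * 3 * (Λ' / c.m) :=
            mul_le_mul (by linarith) hσ' hσ0 (by norm_num)
        _ = 36 * Λ' / c.m := by ring
    linarith

end Cell

end Summit.QuantumFields.YangMills.Theorems.FlatRatioTermination.Cone
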